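import Summits.PneNP.PneNP.Theorems.ExpanderLinearGeneratorsLinearGeneratorModPFregeHardMod2Cert
import Mathlib.Data.List.Sublists
import Mathlib.Algebra.BigOperators.Fin
import HarnessLib

/-!
# `MOD₂` summation, concrete level, III: a row with `s ≥ 1` support variables has `2^(s-1)`
canonical clauses

Support file for item `stmt-PneNP-11444` (`LinearGeneratorModPFregeHard`), calibration line "for
`p = 2` the rung fails".  The row fact of `…Mod2Row.lean` costs `2^|S|` decision-tree leaves for a
row of support `S`; to state the final size bound in terms of the size of the refuted formula
(rather than a sparsity parameter) one needs that the canonical CNF of the row is itself that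
large: exactly half of the `2^|S|` assignments of `S` violate a parity constraint, so
`equationCNF 1 e` has `2^(|S|-1)` clauses (`length_equationCNF_one`), whence
`2^|supp e| ≤ 2·|equationCNF 1 e| + 1` (`two_pow_card_supp_le`) and, summed over distinct rows,
`Σ_{i ∈ T} 2^|supp (E i)| ≤ 2·|sumEncoding 1 E| + m` (`sum_two_pow_card_supp_le`).

No definitions are introduced.

Sources: C. Beck, *Time and Space in Proof Complexity* (2017), Def. 5.6 (the canonical CNF has
one clause per violating assignment); folklore counting.
-/

set_option linter.dupNamespace false -- `Summit.PneNP.PneNP.…`: summit = sub-problem (D-0017)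

namespace Summit.PneNP.PneNP.Theorems.ModTwo

open Literature.Computability.Complexity Literature.Computability.MetaComplexity

section Count

variable {n : ℕ}

/-- Half of the sublists of `a :: V'` satisfy a predicate that flips when `a` is toggled.
[folklore] -/
theorem length_filter_sublists'_of_flip {a : ℕ} {V' : List ℕ} (f : List ℕ → Bool)
    (hflip : ∀ x ∈ V'.sublists', f (a :: x) = !f x) :
    ((a :: V').sublists'.filter f).length = 2 ^ V'.length := by
  rw [List.sublists'_cons, List.filter_append, List.length_append, List.filter_map,
    List.length_map]
  have hc : V'.sublists'.filter (f ∘ List.cons a) = V'.sublists'.filter (fun x => !f x) :=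
    List.filter_congr fun x hx => by simp [Function.comp, hflip x hx]
  rw [hc, ← List.length_eq_length_filter_add, List.length_sublists']

/-- Toggling a support variable flips the parity constraint of the row (block size `1`).
[Beck 2017, Def. 5.6] [folklore] -/
theorem eqPred_one_cons_flip (e : LinEqMod 2 n) {a : ℕ} {x : List ℕ} (ha : a ∉ x)
    (haV : ∃ j ∈ e.supp, (j : ℕ) = a) : eqPred 1 e (a :: x) = !eqPred 1 e x := by
  obtain ⟨j₀, hj₀, rfl⟩ := haV
  have hsum : (∑ j ∈ e.supp, if (j : ℕ) ∈ (j₀ : ℕ) :: x then (1 : ZMod 2) else 0) =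
      1 + ∑ j ∈ e.supp, if (j : ℕ) ∈ x then (1 : ZMod 2) else 0 := by
    have hsplit : ∀ j ∈ e.supp, (if (j : ℕ) ∈ (j₀ : ℕ) :: x then (1 : ZMod 2) else 0) =
        (if j = j₀ then 1 else 0) + (if (j : ℕ) ∈ x then 1 else 0) := by
      intro j _
      by_cases hj : j = j₀
      · subst hj; simp [ha]
      · have : (j : ℕ) ≠ (j₀ : ℕ) := fun h => hj (Fin.ext h)
        simp [List.mem_cons, this, hj]
    rw [Finset.sum_congr rfl hsplit, Finset.sum_add_distrib, Finset.sum_ite_eq' e.supp j₀,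
      if_pos hj₀]
  have key : ∀ (y b : ZMod 2), decide (1 + y = b) = !decide (y = b) := by decide
  rw [Bool.eq_iff_iff, eqPred_one_iff, hsum]
  rw [show (!eqPred 1 e x) = true ↔ ¬ (eqPred 1 e x = true) from by simp, eqPred_one_iff]
  constructor
  · intro h h'
    rw [h'] at h
    exact absurd h (by generalize e.2 = b; revert b; decide)
  · intro h
    have := key (∑ j ∈ e.supp, if (j : ℕ) ∈ x then (1 : ZMod 2) else 0) e.2
    simp only [decide_eq_true_eq, h, decide_false, Bool.not_false] at this
    exact this

/-- **A row with support of size `s ≥ 1` has exactly `2^(s-1)` canonical clauses.**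
[Beck 2017, Def. 5.6] [folklore] -/
theorem length_equationCNF_one (e : LinEqMod 2 n) (he : 1 ≤ e.supp.card) :
    (equationCNF 1 e).length = 2 ^ (e.supp.card - 1) := by
  rw [equationCNF, canonicalCNF, List.length_map,
    ((List.sublists_perm_sublists' _).filter _).length_eq]
  have hV := eqVars_one e
  have hlen : (eqVars 1 e).length = e.supp.card := by rw [length_eqVars, mul_one]
  have hnd : (eqVars 1 e).Nodup := nodup_eqVars 1 e
  -- the variable list is nonempty: `a :: V'`
  obtain ⟨a, V', haV⟩ : ∃ a V', eqVars 1 e = a :: V' := by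
    cases h : eqVars 1 e with
    | nil => rw [h] at hlen; simp at hlen; omega
    | cons a V' => exact ⟨a, V', rfl⟩
  rw [haV] at hlen hnd ⊢
  simp only [List.length_cons] at hlen
  have ha : ∃ j ∈ e.supp, (j : ℕ) = a := by
    have : a ∈ eqVars 1 e := by rw [haV]; exact List.mem_cons_self
    rw [hV] at this
    exact (mem_sort_supp_iff e).1 this
  rw [length_filter_sublists'_of_flip (fun S => !eqPred 1 e S) (fun x hx => ?_)]
  · congr 1; omega
  · have hax : a ∉ x := fun hmem =>
      (List.nodup_cons.1 hnd).1 ((List.mem_sublists'.1 hx).subset hmem)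
    rw [eqPred_one_cons_flip e hax ha, Bool.not_not]

/-- `2^|supp e| ≤ 2·|equationCNF 1 e| + 1` (for empty support the right-hand side is `≥ 1`).
[folklore] -/
theorem two_pow_card_supp_le (e : LinEqMod 2 n) :
    2 ^ e.supp.card ≤ 2 * (equationCNF 1 e).length + 1 := by
  rcases Nat.eq_zero_or_pos e.supp.card with h | h
  · rw [h]; simp
  · rw [length_equationCNF_one e h, ← pow_succ']
    have : e.supp.card - 1 + 1 = e.supp.card := Nat.sub_add_cancel h
    rw [this]; omega

/-- **Summed over distinct rows**: `Σ_{i ∈ T} 2^|supp (E i)| ≤ 2·|sumEncoding 1 E| + m`.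
[folklore] -/
theorem sum_two_pow_card_supp_le {m : ℕ} (E : Fin m → LinEqMod 2 n) (T : Finset (Fin m)) :
    ∑ i ∈ T, 2 ^ (E i).supp.card ≤ 2 * (sumEncoding 1 E).length + m := by
  have hlen : (sumEncoding 1 E).length = ∑ i, (equationCNF 1 (E i)).length := by
    simp only [sumEncoding, List.length_flatMap, Fin.sum_univ_def]
  calc ∑ i ∈ T, 2 ^ (E i).supp.card ≤ ∑ i ∈ T, (2 * (equationCNF 1 (E i)).length + 1) :=
        Finset.sum_le_sum fun i _ => two_pow_card_supp_le (E i)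
    _ ≤ ∑ i, (2 * (equationCNF 1 (E i)).length + 1) :=
        Finset.sum_le_sum_of_subset_of_nonneg (Finset.subset_univ _) (fun _ _ _ => Nat.zero_le _)
    _ = 2 * (sumEncoding 1 E).length + m := by
        rw [Finset.sum_add_distrib, ← Finset.mul_sum, hlen]
        simp

end Count

end Summit.PneNP.PneNP.Theorems.ModTwo
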